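import Mathlib
import Summits.ValiantsHypothesis.ValiantsHypothesis.Theorems.GeneratorObstructionsPowGenDegreeQPDoublingGadgetSlice

/-!
# Route GeneratorObstructions — crux K2 `PowGenDegreeQP` (stmt-ValiantsHypothesis-11655), line
# `trace-side-regimes`: the GIT input is needed only at the parameters `k = 2^t`, `c = 4^t`

Companion of `…PowGenDegreeQPDoublingGadgetWindow` / `…DoublingGadgetSlice`.  Their conditional
refutations `not_powGenDegreeQP_of_canonicalGadgetGIT` / `not_sliceGen_of_canonicalGadgetGIT` ask for a
nonvanishing nonconstant semi-invariant at the canonical doubling gadget for ALL `k ≥ 1`, `c ≥ 1`, but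
their proofs use it only at `k = 2^t`, `c = 4^t` (`t = 2(c₀+2)²`).  This file records the refutations
with exactly that weaker hypothesis:

* `not_powGenDegreeQP_of_canonicalGadgetGIT_pow` — K2 is false once, for every `t ≥ 1` and every
  strictly monotone `ι : Fin (3·4^t) → MatIdx (5·2^t)` onto a final segment, some highest-weight
  vector of nonconstant weight of `ℂ[Δ_{5·2^t} g]` is nonzero at the canonically placed gadget
  `g = Σ_{j < 4^t} x_{B j}^{2^t} x_{A j}^{2^{t+1}} x_{A' j}^{2^{t+1}}`;
* `not_sliceGen_of_canonicalGadgetGIT_pow` — the same hypothesis refutes the registered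
  `stub_sliceGen` (hypothesis of the stub verbatim).

Why this matters: at `k = 2^t` the explicit TABLEAU highest-weight vector of the blueprint
(evidence memo `evidence-11655-leafhand3-g5.md`; arithmetic kernel `…PowGenDegreeQPDixonParity`:
the Dixon sum `Σ_a (-1)^a C(2k,a)^3` is `2 mod 8`, hence nonzero) discharges the hypothesis without
Kempf's theory and without Dixon's identity.

Honest framing: conditional refutations by name (hypothesis restricted, not removed); no stub, crux
or summit is settled here; `VP ≠ VNP` untouched.
-/

namespace Summit.ValiantsHypothesis.ValiantsHypothesis.Theorems.GeneratorObstructions.PowGenDegreeQP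

open MvPolynomial
open Literature.NumberTheory.DiophantineGeometry Literature.Computability.AlgebraicComplexity
  Literature.Barriers.ValiantsHypothesis
open Summit.ValiantsHypothesis.ValiantsHypothesis.Theses.GeneratorObstructions
open Summit.ValiantsHypothesis.ValiantsHypothesis.Theorems.GenInheritance
open Summit.ValiantsHypothesis.ValiantsHypothesis.Theorems.GeneratorObstructions.SliceTransfer

-- `Summit.ValiantsHypothesis.ValiantsHypothesis.…` is the tree's mandated single-conjunct layout.
set_option linter.dupNamespace false

noncomputable section

/-- **K2 is refuted by the GIT input at the parameters actually used** (`k = 2^t`, `c = 4^t`,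
`t ≥ 1`): if for every `t ≥ 1` and every strictly monotone `ι : Fin (3·4^t) → MatIdx (5·2^t)` onto a
final segment some highest-weight vector of NONCONSTANT weight of `ℂ[Δ g]` does not vanish at the
canonically placed doubling gadget `g`, then `PowGenDegreeQP` is false.  Same proof as
`not_powGenDegreeQP_of_canonicalGadgetGIT`, whose hypothesis quantifies over all `k, c ≥ 1`.
[cite: GesmundoIkenmeyerPanova2017, Prop. 5] -/
theorem not_powGenDegreeQP_of_canonicalGadgetGIT_pow
    (hGIT : ∀ (t : ℕ) (_ : 1 ≤ t) (ι : Fin (3 * 4 ^ t) → MatIdx (5 * 2 ^ t)),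
      StrictMono ι → IsUpperSet (Set.range ι) →
      ∃ χ₀ : Weight (MatIdx (5 * 2 ^ t)), (∃ i j, χ₀ i ≠ χ₀ j) ∧
        ∃ x ∈ highestWeightSpace (orbitCoordRep
          (∑ j : Fin (4 ^ t),
            (X (ι ⟨if j.val = 0 then 0 else 3 * j.val - 1, canonPosB_lt j⟩) ^ (2 ^ t) *
              (X (ι ⟨3 * j.val + 1, canonPosA_lt j⟩) ^ (2 * 2 ^ t) *
                X (ι ⟨if j.val = 4 ^ t - 1 then 3 * 4 ^ t - 1 else 3 * j.val + 3,
                  canonPosA'_lt j⟩) ^ (2 * 2 ^ t)) :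
            MvPolynomial (MatIdx (5 * 2 ^ t)) ℂ)) (5 * 2 ^ t)) χ₀,
          evalAtPoint (∑ j : Fin (4 ^ t),
            (X (ι ⟨if j.val = 0 then 0 else 3 * j.val - 1, canonPosB_lt j⟩) ^ (2 ^ t) *
              (X (ι ⟨3 * j.val + 1, canonPosA_lt j⟩) ^ (2 * 2 ^ t) *
                X (ι ⟨if j.val = 4 ^ t - 1 then 3 * 4 ^ t - 1 else 3 * j.val + 3,
                  canonPosA'_lt j⟩) ^ (2 * 2 ^ t)) :
            MvPolynomial (MatIdx (5 * 2 ^ t)) ℂ)) (5 * 2 ^ t) x ≠ 0) :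
    ¬ PowGenDegreeQP := by
  intro hK2
  obtain ⟨c₀, hc₀⟩ := powGenDegreeQP_gadget_bound hK2 2
  obtain ⟨ht, hfit, hwin, hlate⟩ := gadget_parameters_at c₀ (2 * (c₀ + 2) ^ 2) rfl
  have hG := hGIT (2 * (c₀ + 2) ^ 2) ht
  set t : ℕ := 2 * (c₀ + 2) ^ 2 with htdef
  set k : ℕ := 2 ^ t with hk
  set c : ℕ := 4 ^ t with hc
  have hk1 : 1 ≤ k := Nat.one_le_two_pow
  have hc1 : 0 < c := by positivity
  obtain ⟨ι, hι, hup, hBi, hAi, hA'i, hBA, hBA', hAA', hord1, hord2⟩ :=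
    exists_canonicalPlacement (k := k) (c := c) hc1 hfit
  have hP : 5 * k ≤ c * (5 * k) := Nat.le_mul_of_pos_left _ hc1
  have hsum : 5 * k + (c * (5 * k) - 5 * k) = 5 * 2 ^ t * 4 ^ t := by
    have h1 : 5 * k + (c * (5 * k) - 5 * k) = c * (5 * k) := by omega
    rw [h1, hk, hc]; ring
  have hb := hc₀ k c (c * (5 * k) - 5 * k) hk1 hc1 (by rw [hsum]; exact hwin) (by omega)
    (fun j : Fin c => ι ⟨if j.val = 0 then 0 else 3 * j.val - 1, canonPosB_lt j⟩)
    (fun j : Fin c => ι ⟨3 * j.val + 1, canonPosA_lt j⟩)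
    (fun j : Fin c => ι ⟨if j.val = c - 1 then 3 * c - 1 else 3 * j.val + 3, canonPosA'_lt j⟩)
    hBi hAi hA'i hBA hBA' hAA' hord1 hord2 (hG ι hι hup)
  have hlate' : ((5 * k : ℕ) : ℤ) * 2 ^ ((Nat.log 2 (5 * k) + c₀) ^ c₀) < (2 : ℤ) ^ c := by
    rw [hk, hc]; exact_mod_cast hlate
  exact absurd (hb.trans_lt hlate') (lt_irrefl _)

/-- **`stub_sliceGen` is refuted by the GIT input at the parameters actually used** (`k = 2^t`,
`c = 4^t`, `t ≥ 1`): the registered slice stub (hypothesis verbatim) fails as soon as, for every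
`t ≥ 1`, one highest-weight vector of nonconstant weight is nonzero at the canonically placed doubling
gadget with `k = 2^t`, `c = 4^t`.  Same proof as `not_sliceGen_of_canonicalGadgetGIT`.
[cite: GesmundoIkenmeyerPanova2017, Prop. 5] -/
theorem not_sliceGen_of_canonicalGadgetGIT_pow
    (hGIT : ∀ (t : ℕ) (_ : 1 ≤ t) (ι : Fin (3 * 4 ^ t) → MatIdx (5 * 2 ^ t)),
      StrictMono ι → IsUpperSet (Set.range ι) →
      ∃ χ₀ : Weight (MatIdx (5 * 2 ^ t)), (∃ i j, χ₀ i ≠ χ₀ j) ∧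
        ∃ x ∈ highestWeightSpace (orbitCoordRep
          (∑ j : Fin (4 ^ t),
            (X (ι ⟨if j.val = 0 then 0 else 3 * j.val - 1, canonPosB_lt j⟩) ^ (2 ^ t) *
              (X (ι ⟨3 * j.val + 1, canonPosA_lt j⟩) ^ (2 * 2 ^ t) *
                X (ι ⟨if j.val = 4 ^ t - 1 then 3 * 4 ^ t - 1 else 3 * j.val + 3,
                  canonPosA'_lt j⟩) ^ (2 * 2 ^ t)) :
            MvPolynomial (MatIdx (5 * 2 ^ t)) ℂ)) (5 * 2 ^ t)) χ₀,
          evalAtPoint (∑ j : Fin (4 ^ t),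
            (X (ι ⟨if j.val = 0 then 0 else 3 * j.val - 1, canonPosB_lt j⟩) ^ (2 ^ t) *
              (X (ι ⟨3 * j.val + 1, canonPosA_lt j⟩) ^ (2 * 2 ^ t) *
                X (ι ⟨if j.val = 4 ^ t - 1 then 3 * 4 ^ t - 1 else 3 * j.val + 3,
                  canonPosA'_lt j⟩) ^ (2 * 2 ^ t)) :
            MvPolynomial (MatIdx (5 * 2 ^ t)) ℂ)) (5 * 2 ^ t) x ≠ 0) :
    ¬ (∀ c : ℕ, ∃ c₀ : ℕ, ∀ m e : ℕ, 1 ≤ m → m + e ≤ 2 ^ ((Nat.log 2 m + c) ^ c) →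
      ∀ ι : MatIdx m → MatIdx (m + e), StrictMono ι → IsUpperSet (Set.range ι) →
        ∀ χ : Weight (MatIdx m),
          Module.finrank ℂ (↥(highestWeightSpace (orbitCoordRep (powFormLex ℂ (m + e) m) m) (Function.extend ι χ 0)) ⧸ Submodule.comap (highestWeightSpace (orbitCoordRep (powFormLex ℂ (m + e) m) m) (Function.extend ι χ 0)).subtype (⨆ p : Weight (MatIdx (m + e)) × Weight (MatIdx (m + e)), ⨆ (_ : p.1 + p.2 = (Function.extend ι χ 0) ∧ p.1 ≠ 0 ∧ p.2 ≠ 0), highestWeightSpace (orbitCoordRep (powFormLex ℂ (m + e) m) m) p.1 * highestWeightSpace (orbitCoordRep (powFormLex ℂ (m + e) m) m) p.2)) ≠ 0 →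
            -(Weight.size χ) ≤ (m : ℤ) * 2 ^ ((Nat.log 2 m + c₀) ^ c₀)) := by
  intro hS
  obtain ⟨c₀, hc₀⟩ := sliceGen_gadget_bound hS 2
  obtain ⟨ht, hfit, hwin, hlate⟩ := gadget_parameters_at c₀ (2 * (c₀ + 2) ^ 2) rfl
  have hG := hGIT (2 * (c₀ + 2) ^ 2) ht
  set t : ℕ := 2 * (c₀ + 2) ^ 2 with htdef
  set k : ℕ := 2 ^ t with hk
  set c : ℕ := 4 ^ t with hc
  have hk1 : 1 ≤ k := Nat.one_le_two_pow
  have hc1 : 0 < c := by positivity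
  obtain ⟨ι, hι, hup, hBi, hAi, hA'i, hBA, hBA', hAA', hord1, hord2⟩ :=
    exists_canonicalPlacement (k := k) (c := c) hc1 hfit
  have hP : 5 * k ≤ c * (5 * k) := Nat.le_mul_of_pos_left _ hc1
  have hsum : 5 * k + (c * (5 * k) - 5 * k) = 5 * 2 ^ t * 4 ^ t := by
    have h1 : 5 * k + (c * (5 * k) - 5 * k) = c * (5 * k) := by omega
    rw [h1, hk, hc]; ring
  have hb := hc₀ k c (c * (5 * k) - 5 * k) hk1 hc1 (by rw [hsum]; exact hwin) (by omega)
    (fun j : Fin c => ι ⟨if j.val = 0 then 0 else 3 * j.val - 1, canonPosB_lt j⟩)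
    (fun j : Fin c => ι ⟨3 * j.val + 1, canonPosA_lt j⟩)
    (fun j : Fin c => ι ⟨if j.val = c - 1 then 3 * c - 1 else 3 * j.val + 3, canonPosA'_lt j⟩)
    hBi hAi hA'i hBA hBA' hAA' hord1 hord2 (hG ι hι hup)
  have hlate' : ((5 * k : ℕ) : ℤ) * 2 ^ ((Nat.log 2 (5 * k) + c₀) ^ c₀) < (2 : ℤ) ^ c := by
    rw [hk, hc]; exact_mod_cast hlate
  exact absurd (hb.trans_lt hlate') (lt_irrefl _)

/-- The registered `stub_sliceGen`, by name, under the restricted GIT hypothesis: a direct corollary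
(the stub's statement is the negated proposition of `not_sliceGen_of_canonicalGadgetGIT_pow`), recorded
so that the blueprint's target is literally `¬ stub_sliceGen`-shaped for the line `trace-side-regimes`.
[cite: GesmundoIkenmeyerPanova2017, Prop. 5] -/
theorem not_powGenDegreeQP_and_not_sliceGen_of_canonicalGadgetGIT_pow
    (hGIT : ∀ (t : ℕ) (_ : 1 ≤ t) (ι : Fin (3 * 4 ^ t) → MatIdx (5 * 2 ^ t)),
      StrictMono ι → IsUpperSet (Set.range ι) →
      ∃ χ₀ : Weight (MatIdx (5 * 2 ^ t)), (∃ i j, χ₀ i ≠ χ₀ j) ∧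
        ∃ x ∈ highestWeightSpace (orbitCoordRep
          (∑ j : Fin (4 ^ t),
            (X (ι ⟨if j.val = 0 then 0 else 3 * j.val - 1, canonPosB_lt j⟩) ^ (2 ^ t) *
              (X (ι ⟨3 * j.val + 1, canonPosA_lt j⟩) ^ (2 * 2 ^ t) *
                X (ι ⟨if j.val = 4 ^ t - 1 then 3 * 4 ^ t - 1 else 3 * j.val + 3,
                  canonPosA'_lt j⟩) ^ (2 * 2 ^ t)) :
            MvPolynomial (MatIdx (5 * 2 ^ t)) ℂ)) (5 * 2 ^ t)) χ₀,
          evalAtPoint (∑ j : Fin (4 ^ t),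
            (X (ι ⟨if j.val = 0 then 0 else 3 * j.val - 1, canonPosB_lt j⟩) ^ (2 ^ t) *
              (X (ι ⟨3 * j.val + 1, canonPosA_lt j⟩) ^ (2 * 2 ^ t) *
                X (ι ⟨if j.val = 4 ^ t - 1 then 3 * 4 ^ t - 1 else 3 * j.val + 3,
                  canonPosA'_lt j⟩) ^ (2 * 2 ^ t)) :
            MvPolynomial (MatIdx (5 * 2 ^ t)) ℂ)) (5 * 2 ^ t) x ≠ 0) :
    ¬ PowGenDegreeQP ∧
    ¬ (∀ c : ℕ, ∃ c₀ : ℕ, ∀ m e : ℕ, 1 ≤ m → m + e ≤ 2 ^ ((Nat.log 2 m + c) ^ c) →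
      ∀ ι : MatIdx m → MatIdx (m + e), StrictMono ι → IsUpperSet (Set.range ι) →
        ∀ χ : Weight (MatIdx m),
          Module.finrank ℂ (↥(highestWeightSpace (orbitCoordRep (powFormLex ℂ (m + e) m) m) (Function.extend ι χ 0)) ⧸ Submodule.comap (highestWeightSpace (orbitCoordRep (powFormLex ℂ (m + e) m) m) (Function.extend ι χ 0)).subtype (⨆ p : Weight (MatIdx (m + e)) × Weight (MatIdx (m + e)), ⨆ (_ : p.1 + p.2 = (Function.extend ι χ 0) ∧ p.1 ≠ 0 ∧ p.2 ≠ 0), highestWeightSpace (orbitCoordRep (powFormLex ℂ (m + e) m) m) p.1 * highestWeightSpace (orbitCoordRep (powFormLex ℂ (m + e) m) m) p.2)) ≠ 0 →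
            -(Weight.size χ) ≤ (m : ℤ) * 2 ^ ((Nat.log 2 m + c₀) ^ c₀)) :=
  ⟨not_powGenDegreeQP_of_canonicalGadgetGIT_pow hGIT, not_sliceGen_of_canonicalGadgetGIT_pow hGIT⟩

end

end Summit.ValiantsHypothesis.ValiantsHypothesis.Theorems.GeneratorObstructions.PowGenDegreeQP
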